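import Literature.AlgebraicGeometry.Milne1999.LefschetzGroupExteriorAction
import Literature.AlgebraicGeometry.HodgeTheory.MumfordTateGroupExteriorAction
import HarnessLib

/-!
# Milne's character `l : L(A) → 𝔾_m` on the family carrier: it is the similitude multiplier on `H¹`,
# its kernel is `ker l(A)`, `l ∘ w = 2`, and `L(A)(ℂ)/ker l(A)(ℂ) ≅ ℂˣ`; the same for `MT(A) → 𝔾_m` with kernel `Hg(A)`

Milne [Def. 4.3 and p. 659]: `L(A) ⊂ GL(V(A)) × 𝔾_m`, "projection onto `𝔾_m` defines a canonical character `l` of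
`L(A)`", "the kernel of `l(A)` […] equals `S(A)`", "`l ∘ w = -2`" (with Milne's homological `V(A)`; on the tree's
cohomological `H¹` the exponent is `+2`), and the exact commutative diagram of Prop. 4.8
`0 → Hg′(A) → Hg(A) → 𝔾_m → 0` over `0 → S(A) → L(A) → 𝔾_m → 0`.  On the tree's family carrier
`lefschetzGroup n X = powClassSimilitudeGroup X (lefschetzPowClasses n X)` the character is only present as
"`∃ c, G_a x = cᵖ x` on the Lefschetz classes" (`exists_apply_eq_smul_of_mem_lefschetzGroup`).  This file identifies it:

* §1 **normality, hypothesis-free**: the stabiliser of a system of classes is normal in its similitude group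
  (`normal_powClassStabilizer_subgroupOf_powClassSimilitudeGroup`), so `ker l(A) ⊴ L(A)` and `Hg(A) ⊴ MT(A)` on the carriers.
* §2 **the character is the multiplier on `H¹`** (`h` a polarization class, `dim A ≥ 1`): for `g ∈ L(A)(ℂ)` there is a unique
  `c ∈ ℂˣ` with `Q_h(g₁x, g₁y) = c·Q_h(x, y)` (`IsPolarizationClass.existsUnique_multiplier_of_mem_lefschetzGroup`), and then
  `g` acts on every Lefschetz class of degree `2p` of `A` by `cᵖ` (`IsPolarizationClass.apply_eq_pow_smul_of_mem_lefschetzGroup`);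
  `w(c)` has multiplier `c²` (`polarizationPairingOne_weightCocharacter_one`); **`g ∈ ker l(A) ↔ g ∈ L(A) ∧ Q_h(g₁x, g₁y) = Q_h(x, y)`**
  (`IsPolarizationClass.mem_specialLefschetzGroup_iff_mem_lefschetzGroup`); and the same for `MT(A)`: an element of `MT(A)(ℂ)`
  with multiplier `c` acts on the rational `(p,p)`-classes by `cᵖ` (`….apply_eq_pow_smul_of_mem_mumfordTateGroup`) and
  **`g ∈ Hg(A) ↔ g ∈ MT(A) ∧ Q_h(g₁x, g₁y) = Q_h(x, y)`** (`….mem_hodgeGroup_iff_mem_mumfordTateGroup`).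
* §3 **`l` as a homomorphism**: there is a (unique) `l : L(A)(ℂ) →* ℂˣ` with `Q_h(g₁x, g₁y) = l(g)·Q_h(x, y)`; it satisfies
  `g·x = l(g)ᵖ·x` on Lefschetz classes, `l(w(c)) = c²`, is SURJECTIVE, and `ker l = ker l(A)`
  (`IsPolarizationClass.exists_lefschetzCharacter`); hence **`L(A)(ℂ) ⧸ ker l(A)(ℂ) ≅ ℂˣ`**
  (`….nonempty_lefschetzGroup_quotient_mulEquiv_units`), and likewise `MT(A)(ℂ) ⧸ Hg(A)(ℂ) ≅ ℂˣ`
  (`….exists_mumfordTateCharacter`, `….nonempty_mumfordTateGroup_quotient_mulEquiv_units`) — the two rows of the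
  diagram of Prop. 4.8 on `ℂ`-points.

## References

* [Milne1999LefschetzClasses] J. S. Milne, Lefschetz classes on abelian varieties, Duke Math. J. 96 (1999) 639–675,
  §4 Def. 4.3, Thm. 4.4, p. 659 (`l`, `ker l = S`, `l ∘ w = -2`), Prop. 4.8 (p. 660, the diagram).
* [Deligne1982HodgeCycles] P. Deligne, Hodge cycles on abelian varieties, LNM 900 (1982), I §3 (before Thm. 3.8) and proof of Prop. 3.4.
-/

noncomputable section

open CategoryTheory
open Literature.AlgebraicTopology.SingularHomology
open Literature.AlgebraicGeometry.Motives
open Literature.AlgebraicGeometry.HodgeTheory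
open Literature.AlgebraicGeometry.VanGeemen1994 (hodgeGroupOne mem_hodgeGroupOne_iff)
open Literature.Barriers.HodgeConjecture (divisorClassesSpan)

namespace Literature.AlgebraicGeometry.Milne1999

/-! ### §1 The stabiliser is normal in the similitude group -/

section Normal

variable {X : SchemeOver ℂ} (S : ∀ a p : ℕ, Set (complexBetti (cartesianPow X (a + 1)) (2 * p)))

/-- **`Stab(S) ⊴ Sim(S)`**: the subgroup of families FIXING a system of classes on the powers is normal in the subgroup of
families acting on it through a character (conjugation: `G S G⁻¹ x = G S (c⁻ᵖ x) = G (c⁻ᵖ x) = x`).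
[cite: Milne1999LefschetzClasses, §4 p. 659 (ker l = S(A))] -/
theorem _root_.Literature.AlgebraicGeometry.HodgeTheory.normal_powClassStabilizer_subgroupOf_powClassSimilitudeGroup :
    ((powClassStabilizer X S).subgroupOf (powClassSimilitudeGroup X S)).Normal := by
  rw [Subgroup.normal_subgroupOf_iff powClassStabilizer_le_powClassSimilitudeGroup]
  rintro s g ⟨T, hT, rfl, hTS⟩ ⟨G, hG, rfl, c, hGS⟩
  refine ⟨G * T * G⁻¹, (hG.mul hT).mul hG.inv, rfl, fun a p x hx ↦ ?_⟩
  have hinv : (G a (2 * p))⁻¹ x = ((c : ℂ) ^ p)⁻¹ • x := by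
    rw [LinearEquiv.coe_inv, LinearEquiv.symm_apply_eq, map_smul, hGS a p x hx, smul_smul,
      inv_mul_cancel₀ (pow_ne_zero _ c.ne_zero), one_smul]
  simp only [Pi.mul_apply, Pi.inv_apply, LinearEquiv.mul_apply]
  rw [hinv, map_smul, hTS a p x hx, map_smul, hGS a p x hx, smul_smul,
    inv_mul_cancel₀ (pow_ne_zero _ c.ne_zero), one_smul]

/-- **`ker l(A) ⊴ L(A)`** on the family carriers (every smooth projective `X`, every `n`). [cite: Milne1999LefschetzClasses, §4 p. 659] -/
theorem normal_specialLefschetzGroup_subgroupOf_lefschetzGroup (n : ℕ) :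
    ((specialLefschetzGroup n X).subgroupOf (lefschetzGroup n X)).Normal :=
  normal_powClassStabilizer_subgroupOf_powClassSimilitudeGroup _

/-- **`Hg(X) ⊴ MT(X)`** on the family carriers. [cite: Deligne1982HodgeCycles, I §3 (Hg = kernel of MT → 𝔾_m)] -/
theorem _root_.Literature.AlgebraicGeometry.HodgeTheory.normal_hodgeGroup_subgroupOf_mumfordTateGroup (n : ℕ) :
    ((hodgeGroup n X).subgroupOf (mumfordTateGroup n X)).Normal :=
  normal_powClassStabilizer_subgroupOf_powClassSimilitudeGroup _

end Normal

/-! ### §2 The character is the similitude multiplier on `H¹` -/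

section Multiplier

variable {A : AbelianVariety ℂ} {h : complexBetti A.X 2} {g : ∀ k : ℕ, complexBetti A.X k ≃ₗ[ℂ] complexBetti A.X k}

/-- For a polarization class on a positive-dimensional abelian variety the form `Q_h` on `H¹` is not identically zero
(it is non-degenerate and `H¹ ≠ 0`). [cite: Milne1999LefschetzClasses, §4 p. 659 (l is well defined)] -/
theorem _root_.Literature.AlgebraicGeometry.HodgeTheory.IsPolarizationClass.exists_polarizationPairingOne_ne_zero
    (hpol : IsPolarizationClass A.dim A.X h) (hA : 1 ≤ A.dim) :
    ∃ x y : complexBetti A.X 1, polarizationPairingOne A.X h (A.dim - 1) x y ≠ 0 := by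
  haveI : Module.Finite ℂ (complexBetti A.X 1) := abelianVarietyCohomologyExteriorH1_holds.finite_one A
  have hV : 0 < Module.finrank ℂ (complexBetti A.X 1) := by
    rw [AbelianVariety.finrank_complexBetti_one]; omega
  obtain ⟨x, hx⟩ := Module.finrank_pos_iff_exists_ne_zero.1 hV
  by_contra H
  refine hx (eq_zero_of_forall_polarizationPairingOne_eq_zero_of_hasHardLefschetzProperty hA hpol.hasHardLefschetz
    fun y ↦ ?_)
  by_contra hy
  exact H ⟨x, y, hy⟩

/-- **`l ∘ w = 2` on `H¹`**: `Q_h(w(c)x, w(c)y) = c²·Q_h(x, y)` (Milne's `l ∘ w = -2` for the homological `V(A)`).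
[cite: Milne1999LefschetzClasses, §4 p. 659 (l ∘ w = -2)] -/
theorem polarizationPairingOne_weightCocharacter_one (h : complexBetti A.X 2) (c : ℂˣ) (x y : complexBetti A.X 1) :
    polarizationPairingOne A.X h (A.dim - 1) (weightCocharacter A.X c 1 x) (weightCocharacter A.X c 1 y) =
      (((c ^ 2 : ℂˣ) : ℂ)) • polarizationPairingOne A.X h (A.dim - 1) x y := by
  rw [weightCocharacter_apply, weightCocharacter_apply, pow_one, LinearMap.map_smul₂, map_smul, smul_smul,
    Units.val_pow_eq_pow_val, pow_two]

/-- **The character of `g ∈ L(A)(ℂ)` is a multiplier on `H¹` and acts on the Lefschetz classes**: writing `g = w(c)·s` with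
`s ∈ ker l` (`L = w(𝔾_m)·ker l`), `s₁ ∈ S(A)(h)(ℂ)` is `Q_h`-unitary (Thm. 4.4), so `Q_h(g₁x, g₁y) = c²Q_h(x, y)` and `g` acts on
`D^p(A) ⊗ ℂ` by `c^{2p}` (`h` a polarization class, `dim A ≥ 1`). [cite: Milne1999LefschetzClasses, Def. 4.3, Thm. 4.4 and p. 659] -/
theorem _root_.Literature.AlgebraicGeometry.HodgeTheory.IsPolarizationClass.exists_multiplier_of_mem_lefschetzGroup
    (hpol : IsPolarizationClass A.dim A.X h) (hA : 1 ≤ A.dim) (hg : g ∈ lefschetzGroup A.dim A.X) :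
    ∃ c : ℂˣ, (∀ x y : complexBetti A.X 1, polarizationPairingOne A.X h (A.dim - 1) (g 1 x) (g 1 y) =
        (c : ℂ) • polarizationPairingOne A.X h (A.dim - 1) x y) ∧
      ∀ (p : ℕ), ∀ x ∈ divisorClassesSpan A.X A.dim p, g (2 * p) x = ((c : ℂ) ^ p) • x := by
  obtain ⟨c, s, hs, rfl⟩ := mem_lefschetzGroup_iff_exists_weightCocharacter_mul.1 hg
  have hs1 : s 1 ∈ unitaryCentralizerGroup A h := (hpol.specialLefschetzGroup_map_one_eq hA).le ⟨s, hs, rfl⟩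
  refine ⟨c ^ 2, fun x y ↦ ?_, fun p x hx ↦ ?_⟩
  · rw [Pi.mul_apply, LinearEquiv.mul_apply, LinearEquiv.mul_apply, polarizationPairingOne_weightCocharacter_one,
      hs1.2 x y]
  · rw [Pi.mul_apply, LinearEquiv.mul_apply, apply_eq_self_of_mem_specialLefschetzGroup hs hx, weightCocharacter_apply,
      Units.val_pow_eq_pow_val, ← pow_mul]

/-- **The multiplier of `g ∈ L(A)(ℂ)` on `H¹` exists and is unique** (`h` a polarization class, `dim A ≥ 1`).
[cite: Milne1999LefschetzClasses, §4 p. 659 (the character l)] -/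
theorem _root_.Literature.AlgebraicGeometry.HodgeTheory.IsPolarizationClass.existsUnique_multiplier_of_mem_lefschetzGroup
    (hpol : IsPolarizationClass A.dim A.X h) (hA : 1 ≤ A.dim) (hg : g ∈ lefschetzGroup A.dim A.X) :
    ∃! c : ℂˣ, ∀ x y : complexBetti A.X 1, polarizationPairingOne A.X h (A.dim - 1) (g 1 x) (g 1 y) =
      (c : ℂ) • polarizationPairingOne A.X h (A.dim - 1) x y := by
  obtain ⟨c, hc, -⟩ := hpol.exists_multiplier_of_mem_lefschetzGroup hA hg
  exact ⟨c, hc, fun d hd ↦ multiplier_unique hd hc (hpol.exists_polarizationPairingOne_ne_zero hA)⟩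

/-- **`l(g)` on the Lefschetz classes IS the multiplier of `g₁`**: if `Q_h(g₁x, g₁y) = c·Q_h(x, y)` then `g x = cᵖ x` for every
Lefschetz class `x` of degree `2p` on `A` (`h` a polarization class, `dim A ≥ 1`). [cite: Milne1999LefschetzClasses, Def. 4.3 and p. 659] -/
theorem _root_.Literature.AlgebraicGeometry.HodgeTheory.IsPolarizationClass.apply_eq_pow_smul_of_mem_lefschetzGroup
    (hpol : IsPolarizationClass A.dim A.X h) (hA : 1 ≤ A.dim) (hg : g ∈ lefschetzGroup A.dim A.X) {c : ℂˣ}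
    (hc : ∀ x y : complexBetti A.X 1, polarizationPairingOne A.X h (A.dim - 1) (g 1 x) (g 1 y) =
      (c : ℂ) • polarizationPairingOne A.X h (A.dim - 1) x y)
    {p : ℕ} {x : complexBetti A.X (2 * p)} (hx : x ∈ divisorClassesSpan A.X A.dim p) : g (2 * p) x = ((c : ℂ) ^ p) • x := by
  obtain ⟨c₀, hc₀, hact⟩ := hpol.exists_multiplier_of_mem_lefschetzGroup hA hg
  obtain rfl : c = c₀ := multiplier_unique hc hc₀ (hpol.exists_polarizationPairingOne_ne_zero hA)
  exact hact p x hx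

/-- **`ker l(A) = {g ∈ L(A) | Q_h(g₁x, g₁y) = Q_h(x, y)}`** on the family carriers ("the kernel of `l(A)` […] equals `S(A)`";
`h` a polarization class, `dim A ≥ 1`): an element of `L(A)(ℂ)` with unitary `H¹`-component has that component in
`S(A)(h)(ℂ) = ker l(A)(ℂ)|_{H¹}` (Thm. 4.4) and is determined by it (`lefschetzGroup_ext_one`). [cite: Milne1999LefschetzClasses, Thm. 4.4 and §4 p. 659] -/
theorem _root_.Literature.AlgebraicGeometry.HodgeTheory.IsPolarizationClass.mem_specialLefschetzGroup_iff_mem_lefschetzGroup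
    (hpol : IsPolarizationClass A.dim A.X h) (hA : 1 ≤ A.dim) :
    g ∈ specialLefschetzGroup A.dim A.X ↔ g ∈ lefschetzGroup A.dim A.X ∧
      ∀ x y : complexBetti A.X 1, polarizationPairingOne A.X h (A.dim - 1) (g 1 x) (g 1 y) =
        polarizationPairingOne A.X h (A.dim - 1) x y := by
  constructor
  · intro hg
    exact ⟨specialLefschetzGroup_le_lefschetzGroup hg, ((hpol.specialLefschetzGroup_map_one_eq hA).le ⟨g, hg, rfl⟩).2⟩
  · rintro ⟨hg, hQ⟩
    have hC : g 1 ∈ centralizerGroup A :=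
      (similitudeCentralizerGroup_le_centralizerGroup ((hpol.lefschetzGroup_map_one_eq hA).le ⟨g, hg, rfl⟩))
    have h1 : g 1 ∈ unitaryCentralizerGroup A h := ⟨hC, hQ⟩
    rw [← hpol.specialLefschetzGroup_map_one_eq hA] at h1
    obtain ⟨s, hs, e⟩ := h1
    rw [← lefschetzGroup_ext_one hA (specialLefschetzGroup_le_lefschetzGroup hs) hg e]
    exact hs

/-- **The character of `m ∈ MT(A)(ℂ)` is a multiplier on `H¹` and acts on the Hodge classes**: `m = w(c)·g` with `g ∈ Hg(A)(ℂ)`,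
`g₁ ∈ Hg(A)(ℂ)|_{H¹} ≤ S(A)(h)(ℂ)`, so `Q_h(m₁x, m₁y) = c²Q_h(x, y)` and `m` acts on the rational `(p,p)`-classes by `c^{2p}`.
[cite: Deligne1982HodgeCycles, I §3 and proof of Prop. 3.4] [cite: Milne1999LefschetzClasses, Prop. 4.8 (the diagram, p. 660)] -/
theorem _root_.Literature.AlgebraicGeometry.HodgeTheory.IsPolarizationClass.exists_multiplier_of_mem_mumfordTateGroup
    (hpol : IsPolarizationClass A.dim A.X h) (hm : g ∈ mumfordTateGroup A.dim A.X) :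
    ∃ c : ℂˣ, (∀ x y : complexBetti A.X 1, polarizationPairingOne A.X h (A.dim - 1) (g 1 x) (g 1 y) =
        (c : ℂ) • polarizationPairingOne A.X h (A.dim - 1) x y) ∧
      ∀ (p : ℕ) (x : complexBetti A.X (2 * p)), IsRationalClass x → IsOfHodgeType A.dim A.X (2 * p) p p x →
        g (2 * p) x = ((c : ℂ) ^ p) • x := by
  obtain ⟨c, s, hs, rfl⟩ := mem_mumfordTateGroup_iff_exists_weightCocharacter_mul.1 hm
  have hs1 : s 1 ∈ unitaryCentralizerGroup A h :=
    hodgeGroupOne_le_unitaryCentralizerGroup hpol.mem_hodgeClassSpan_one (mem_hodgeGroupOne_iff.2 ⟨s, hs, rfl⟩)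
  refine ⟨c ^ 2, fun x y ↦ ?_, fun p x hQ hpp ↦ ?_⟩
  · rw [Pi.mul_apply, LinearEquiv.mul_apply, LinearEquiv.mul_apply, polarizationPairingOne_weightCocharacter_one,
      hs1.2 x y]
  · rw [Pi.mul_apply, LinearEquiv.mul_apply, apply_eq_self_of_mem_hodgeGroup hs hQ hpp, weightCocharacter_apply,
      Units.val_pow_eq_pow_val, ← pow_mul]

/-- **The character of `MT(A)` on the Hodge classes IS the multiplier on `H¹`**: if `Q_h(m₁x, m₁y) = c·Q_h(x, y)` then
`m x = cᵖ x` for every rational `(p,p)`-class `x` on `A` (`h` a polarization class, `dim A ≥ 1`). [cite: Deligne1982HodgeCycles, I §3 and Prop. 3.4] -/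
theorem _root_.Literature.AlgebraicGeometry.HodgeTheory.IsPolarizationClass.apply_eq_pow_smul_of_mem_mumfordTateGroup
    (hpol : IsPolarizationClass A.dim A.X h) (hA : 1 ≤ A.dim) (hm : g ∈ mumfordTateGroup A.dim A.X) {c : ℂˣ}
    (hc : ∀ x y : complexBetti A.X 1, polarizationPairingOne A.X h (A.dim - 1) (g 1 x) (g 1 y) =
      (c : ℂ) • polarizationPairingOne A.X h (A.dim - 1) x y)
    {p : ℕ} {x : complexBetti A.X (2 * p)} (hQ : IsRationalClass x) (hpp : IsOfHodgeType A.dim A.X (2 * p) p p x) :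
    g (2 * p) x = ((c : ℂ) ^ p) • x := by
  obtain ⟨c₀, hc₀, hact⟩ := hpol.exists_multiplier_of_mem_mumfordTateGroup hm
  obtain rfl : c = c₀ := multiplier_unique hc hc₀ (hpol.exists_polarizationPairingOne_ne_zero hA)
  exact hact p x hQ hpp

/-- **`Hg(A) = {m ∈ MT(A) | Q_h(m₁x, m₁y) = Q_h(x, y)}`** on the family carriers (`Hg′ = ker(Hg → 𝔾_m)` in Milne's notation;
`h` a polarization class, `dim A ≥ 1`): `MT(A)(ℂ)|_{H¹} ∩ S(A)(h)(ℂ) = Hg(A)(ℂ)|_{H¹}` and `MT` is faithful on `H¹`.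
[cite: Deligne1982HodgeCycles, I §3 (before Thm. 3.8)] [cite: Milne1999LefschetzClasses, Prop. 4.8 (p. 660)] -/
theorem _root_.Literature.AlgebraicGeometry.HodgeTheory.IsPolarizationClass.mem_hodgeGroup_iff_mem_mumfordTateGroup
    (hpol : IsPolarizationClass A.dim A.X h) (hA : 1 ≤ A.dim) :
    g ∈ hodgeGroup A.dim A.X ↔ g ∈ mumfordTateGroup A.dim A.X ∧
      ∀ x y : complexBetti A.X 1, polarizationPairingOne A.X h (A.dim - 1) (g 1 x) (g 1 y) =
        polarizationPairingOne A.X h (A.dim - 1) x y := by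
  constructor
  · intro hg
    exact ⟨hodgeGroup_le_mumfordTateGroup hg,
      (hodgeGroupOne_le_unitaryCentralizerGroup hpol.mem_hodgeClassSpan_one (mem_hodgeGroupOne_iff.2 ⟨g, hg, rfl⟩)).2⟩
  · rintro ⟨hm, hQ⟩
    have hL : g ∈ lefschetzGroup A.dim A.X := mumfordTateGroup_le_lefschetzGroup AbelianVariety.isSmoothProjective_holds hm
    have hC : g 1 ∈ centralizerGroup A :=
      similitudeCentralizerGroup_le_centralizerGroup ((hpol.lefschetzGroup_map_one_eq hA).le ⟨g, hL, rfl⟩)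
    have h1 : g 1 ∈ hodgeGroupOne A.dim A.X :=
      (mem_hodgeGroupOne_iff_mem_map_mumfordTateGroup_and_mem_unitaryCentralizerGroup hpol hA).2 ⟨⟨g, hm, rfl⟩, hC, hQ⟩
    obtain ⟨s, hs, e⟩ := mem_hodgeGroupOne_iff.1 h1
    rw [← mumfordTateGroup_ext_one (hodgeGroup_le_mumfordTateGroup hs) hm e]
    exact hs

end Multiplier

/-! ### §3 `l` as a homomorphism: surjective, kernel `ker l(A)`, and `L(A)(ℂ) ⧸ ker l(A)(ℂ) ≅ ℂˣ`; the same for `MT(A)` -/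

section Character

variable {A : AbelianVariety ℂ} {h : complexBetti A.X 2}

/-- Every unit of `ℂ` is a square of a unit. [folklore] -/
private theorem exists_units_sq_eq_complex (d : ℂˣ) : ∃ r : ℂˣ, r ^ 2 = d := by
  obtain ⟨z, hz⟩ := IsAlgClosed.exists_pow_nat_eq (d : ℂ) (by norm_num : 0 < 2)
  have hz0 : z ≠ 0 := by
    rintro rfl
    rw [zero_pow two_ne_zero] at hz
    exact d.ne_zero hz.symm
  exact ⟨Units.mk0 z hz0, Units.ext (by rw [Units.val_pow_eq_pow_val, Units.val_mk0, hz])⟩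

/-- **Milne's character `l : L(A) → 𝔾_m` on the family carrier** (`h` a polarization class, `dim A ≥ 1`): there is a homomorphism
`l : L(A)(ℂ) →* ℂˣ` such that `l(g)` is the multiplier of `g₁` for `Q_h`, `g` acts on the Lefschetz classes of degree `2p` by
`l(g)ᵖ`, `l(w(c)) = c²`, `l` is surjective, and `ker l = ker l(A)(ℂ)`. [cite: Milne1999LefschetzClasses, Def. 4.3, Thm. 4.4 and §4 p. 659] -/
theorem _root_.Literature.AlgebraicGeometry.HodgeTheory.IsPolarizationClass.exists_lefschetzCharacter
    (hpol : IsPolarizationClass A.dim A.X h) (hA : 1 ≤ A.dim) :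
    ∃ l : lefschetzGroup A.dim A.X →* ℂˣ,
      (∀ (g : lefschetzGroup A.dim A.X) (x y : complexBetti A.X 1),
        polarizationPairingOne A.X h (A.dim - 1) ((g : ∀ k : ℕ, complexBetti A.X k ≃ₗ[ℂ] complexBetti A.X k) 1 x)
          ((g : ∀ k : ℕ, complexBetti A.X k ≃ₗ[ℂ] complexBetti A.X k) 1 y) =
          ((l g : ℂˣ) : ℂ) • polarizationPairingOne A.X h (A.dim - 1) x y) ∧
      (∀ (g : lefschetzGroup A.dim A.X) (p : ℕ), ∀ x ∈ divisorClassesSpan A.X A.dim p,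
        (g : ∀ k : ℕ, complexBetti A.X k ≃ₗ[ℂ] complexBetti A.X k) (2 * p) x = (((l g : ℂˣ) : ℂ) ^ p) • x) ∧
      (∀ c : ℂˣ, l ⟨weightCocharacter A.X c, weightCocharacter_mem_lefschetzGroup c⟩ = c ^ 2) ∧
      Function.Surjective l ∧
      l.ker = (specialLefschetzGroup A.dim A.X).subgroupOf (lefschetzGroup A.dim A.X) := by
  classical
  have hQ0 := hpol.exists_polarizationPairingOne_ne_zero hA
  choose c hc using fun g : lefschetzGroup A.dim A.X ↦ hpol.existsUnique_multiplier_of_mem_lefschetzGroup hA g.2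
  have huniq : ∀ (g : lefschetzGroup A.dim A.X) (d : ℂˣ),
      (∀ x y : complexBetti A.X 1, polarizationPairingOne A.X h (A.dim - 1)
        ((g : ∀ k : ℕ, complexBetti A.X k ≃ₗ[ℂ] complexBetti A.X k) 1 x)
        ((g : ∀ k : ℕ, complexBetti A.X k ≃ₗ[ℂ] complexBetti A.X k) 1 y) =
          (d : ℂ) • polarizationPairingOne A.X h (A.dim - 1) x y) → d = c g :=
    fun g d hd ↦ multiplier_unique hd (hc g).1 hQ0
  let l : lefschetzGroup A.dim A.X →* ℂˣ :=
    { toFun := c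
      map_one' := (huniq 1 1 fun x y ↦ by
        rw [Units.val_one, one_smul, Subgroup.coe_one, Pi.one_apply, LinearEquiv.coe_one, id_eq, id_eq]).symm
      map_mul' := fun g g' ↦ (huniq (g * g') (c g * c g') fun x y ↦ by
        simp only [Subgroup.coe_mul, Pi.mul_apply, LinearEquiv.mul_apply]
        rw [(hc g).1, (hc g').1, smul_smul, Units.val_mul]).symm }
  have hl : ∀ g, l g = c g := fun _ ↦ rfl
  have hw : ∀ c₀ : ℂˣ, l ⟨weightCocharacter A.X c₀, weightCocharacter_mem_lefschetzGroup c₀⟩ = c₀ ^ 2 := fun c₀ ↦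
    (huniq ⟨weightCocharacter A.X c₀, weightCocharacter_mem_lefschetzGroup c₀⟩ (c₀ ^ 2)
      fun x y ↦ polarizationPairingOne_weightCocharacter_one h c₀ x y).symm
  refine ⟨l, fun g ↦ (hc g).1, fun g p x hx ↦ hpol.apply_eq_pow_smul_of_mem_lefschetzGroup hA g.2 (hc g).1 hx, hw,
    fun d ↦ ?_, ?_⟩
  · obtain ⟨r, rfl⟩ := exists_units_sq_eq_complex d
    exact ⟨_, hw r⟩
  · ext g
    rw [MonoidHom.mem_ker, Subgroup.mem_subgroupOf, hpol.mem_specialLefschetzGroup_iff_mem_lefschetzGroup hA, hl]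
    constructor
    · intro h1
      refine ⟨g.2, fun x y ↦ ?_⟩
      rw [(hc g).1 x y, h1, Units.val_one, one_smul]
    · rintro ⟨-, hQ⟩
      exact (huniq g 1 fun x y ↦ by rw [hQ, Units.val_one, one_smul]).symm

/-- **`L(A)(ℂ) ⧸ ker l(A)(ℂ) ≅ ℂˣ`** (the row `0 → S(A) → L(A) → 𝔾_m → 0` of the diagram of Prop. 4.8, on `ℂ`-points; `dim A ≥ 1`).
[cite: Milne1999LefschetzClasses, Prop. 4.8 (p. 660, the diagram) and §4 p. 659] -/
theorem _root_.Literature.AlgebraicGeometry.HodgeTheory.IsPolarizationClass.nonempty_lefschetzGroup_quotient_mulEquiv_units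
    (hpol : IsPolarizationClass A.dim A.X h) (hA : 1 ≤ A.dim) :
    letI : ((specialLefschetzGroup A.dim A.X).subgroupOf (lefschetzGroup A.dim A.X)).Normal :=
      normal_specialLefschetzGroup_subgroupOf_lefschetzGroup A.dim
    Nonempty (lefschetzGroup A.dim A.X ⧸ (specialLefschetzGroup A.dim A.X).subgroupOf (lefschetzGroup A.dim A.X) ≃* ℂˣ) := by
  obtain ⟨l, -, -, -, hsurj, hker⟩ := hpol.exists_lefschetzCharacter hA
  haveI : ((specialLefschetzGroup A.dim A.X).subgroupOf (lefschetzGroup A.dim A.X)).Normal :=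
    normal_specialLefschetzGroup_subgroupOf_lefschetzGroup A.dim
  exact ⟨(QuotientGroup.quotientMulEquivOfEq hker).symm.trans (QuotientGroup.quotientKerEquivOfSurjective l hsurj)⟩

/-- **The character `MT(A) → 𝔾_m` on the family carrier** (`h` a polarization class, `dim A ≥ 1`): a homomorphism
`ν : MT(A)(ℂ) →* ℂˣ` with `ν(m)` the multiplier of `m₁` for `Q_h`, `m` acting on the rational `(p,p)`-classes by `ν(m)ᵖ`,
`ν(w(c)) = c²`, surjective, with kernel `Hg(A)(ℂ)`. [cite: Deligne1982HodgeCycles, I §3 and proof of Prop. 3.4] [cite: Milne1999LefschetzClasses, Prop. 4.8 (p. 660)] -/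
theorem _root_.Literature.AlgebraicGeometry.HodgeTheory.IsPolarizationClass.exists_mumfordTateCharacter
    (hpol : IsPolarizationClass A.dim A.X h) (hA : 1 ≤ A.dim) :
    ∃ ν : mumfordTateGroup A.dim A.X →* ℂˣ,
      (∀ (m : mumfordTateGroup A.dim A.X) (x y : complexBetti A.X 1),
        polarizationPairingOne A.X h (A.dim - 1) ((m : ∀ k : ℕ, complexBetti A.X k ≃ₗ[ℂ] complexBetti A.X k) 1 x)
          ((m : ∀ k : ℕ, complexBetti A.X k ≃ₗ[ℂ] complexBetti A.X k) 1 y) =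
          ((ν m : ℂˣ) : ℂ) • polarizationPairingOne A.X h (A.dim - 1) x y) ∧
      (∀ (m : mumfordTateGroup A.dim A.X) (p : ℕ) (x : complexBetti A.X (2 * p)), IsRationalClass x →
        IsOfHodgeType A.dim A.X (2 * p) p p x →
        (m : ∀ k : ℕ, complexBetti A.X k ≃ₗ[ℂ] complexBetti A.X k) (2 * p) x = (((ν m : ℂˣ) : ℂ) ^ p) • x) ∧
      (∀ c : ℂˣ, ν ⟨weightCocharacter A.X c, weightCocharacter_mem_mumfordTateGroup c⟩ = c ^ 2) ∧
      Function.Surjective ν ∧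
      ν.ker = (hodgeGroup A.dim A.X).subgroupOf (mumfordTateGroup A.dim A.X) := by
  classical
  have hX : IsSmoothProjective A.dim A.X := AbelianVariety.isSmoothProjective_holds (A := A)
  have hQ0 := hpol.exists_polarizationPairingOne_ne_zero hA
  choose c hc using fun m : mumfordTateGroup A.dim A.X ↦
    hpol.existsUnique_multiplier_of_mem_lefschetzGroup hA (mumfordTateGroup_le_lefschetzGroup hX m.2)
  have huniq : ∀ (m : mumfordTateGroup A.dim A.X) (d : ℂˣ),
      (∀ x y : complexBetti A.X 1, polarizationPairingOne A.X h (A.dim - 1)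
        ((m : ∀ k : ℕ, complexBetti A.X k ≃ₗ[ℂ] complexBetti A.X k) 1 x)
        ((m : ∀ k : ℕ, complexBetti A.X k ≃ₗ[ℂ] complexBetti A.X k) 1 y) =
          (d : ℂ) • polarizationPairingOne A.X h (A.dim - 1) x y) → d = c m :=
    fun m d hd ↦ multiplier_unique hd (hc m).1 hQ0
  let ν : mumfordTateGroup A.dim A.X →* ℂˣ :=
    { toFun := c
      map_one' := (huniq 1 1 fun x y ↦ by
        rw [Units.val_one, one_smul, Subgroup.coe_one, Pi.one_apply, LinearEquiv.coe_one, id_eq, id_eq]).symm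
      map_mul' := fun m m' ↦ (huniq (m * m') (c m * c m') fun x y ↦ by
        simp only [Subgroup.coe_mul, Pi.mul_apply, LinearEquiv.mul_apply]
        rw [(hc m).1, (hc m').1, smul_smul, Units.val_mul]).symm }
  have hl : ∀ m, ν m = c m := fun _ ↦ rfl
  have hw : ∀ c₀ : ℂˣ, ν ⟨weightCocharacter A.X c₀, weightCocharacter_mem_mumfordTateGroup c₀⟩ = c₀ ^ 2 := fun c₀ ↦
    (huniq ⟨weightCocharacter A.X c₀, weightCocharacter_mem_mumfordTateGroup c₀⟩ (c₀ ^ 2)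
      fun x y ↦ polarizationPairingOne_weightCocharacter_one h c₀ x y).symm
  refine ⟨ν, fun m ↦ (hc m).1, fun m p x hQ hpp ↦ hpol.apply_eq_pow_smul_of_mem_mumfordTateGroup hA m.2 (hc m).1 hQ hpp,
    hw, fun d ↦ ?_, ?_⟩
  · obtain ⟨r, rfl⟩ := exists_units_sq_eq_complex d
    exact ⟨_, hw r⟩
  · ext m
    rw [MonoidHom.mem_ker, Subgroup.mem_subgroupOf, hpol.mem_hodgeGroup_iff_mem_mumfordTateGroup hA, hl]
    constructor
    · intro h1
      refine ⟨m.2, fun x y ↦ ?_⟩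
      rw [(hc m).1 x y, h1, Units.val_one, one_smul]
    · rintro ⟨-, hQ⟩
      exact (huniq m 1 fun x y ↦ by rw [hQ, Units.val_one, one_smul]).symm

/-- **`MT(A)(ℂ) ⧸ Hg(A)(ℂ) ≅ ℂˣ`** (the row `0 → Hg′(A) → Hg(A) → 𝔾_m → 0` of the diagram of Prop. 4.8, on `ℂ`-points; `dim A ≥ 1`).
[cite: Milne1999LefschetzClasses, Prop. 4.8 (p. 660, the diagram)] [cite: Deligne1982HodgeCycles, I §3] -/
theorem _root_.Literature.AlgebraicGeometry.HodgeTheory.IsPolarizationClass.nonempty_mumfordTateGroup_quotient_mulEquiv_units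
    (hpol : IsPolarizationClass A.dim A.X h) (hA : 1 ≤ A.dim) :
    letI : ((hodgeGroup A.dim A.X).subgroupOf (mumfordTateGroup A.dim A.X)).Normal :=
      normal_hodgeGroup_subgroupOf_mumfordTateGroup A.dim
    Nonempty (mumfordTateGroup A.dim A.X ⧸ (hodgeGroup A.dim A.X).subgroupOf (mumfordTateGroup A.dim A.X) ≃* ℂˣ) := by
  obtain ⟨ν, -, -, -, hsurj, hker⟩ := hpol.exists_mumfordTateCharacter hA
  haveI : ((hodgeGroup A.dim A.X).subgroupOf (mumfordTateGroup A.dim A.X)).Normal :=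
    normal_hodgeGroup_subgroupOf_mumfordTateGroup A.dim
  exact ⟨(QuotientGroup.quotientMulEquivOfEq hker).symm.trans (QuotientGroup.quotientKerEquivOfSurjective ν hsurj)⟩

end Character

end Literature.AlgebraicGeometry.Milne1999
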